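import Literature.RepresentationTheory.HeisenbergGroup.SchrodingerSymplecticGenerators
import Literature.RepresentationTheory.HeisenbergGroup.ImplementerCocycle
import HarnessLib

/-!
# Conjugating implementers inside `S̃p_ψ(W)`: `M₀ U M₀⁻¹ = c · N`, and the Siegel-unipotent case

Topic `RepresentationTheory/HeisenbergGroup`; namespace `Literature.RepresentationTheory.HeisenbergGroup`.  THEOREMS ONLY
(no definition, no named fact, no `sorry`).

[MoeglinVignerasWaldspurger1987, Chap. 2 II.1 (A)]: for `(g, M) ∈ S̃p_ψ(W)` the operator `M` is determined by `g` up to a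
scalar («De plus `M` est unique à un scalaire près») — in the tree the predicate `ImplementerUniqueUpToScalar ρ` on the
model `ρ` (kernel for the local Schrödinger models: `implementerUniqueUpToScalar_localSchrodinger`,
`implementerUniqueUpToScalar_schrodingerSB_gram`).  Consequences packaged here, for any model `ρ` of the Heisenberg
group of `(W, B)` on `S` with that property:

* §1 `MpPsi.exists_toOp_eq_smul` — `(g, M) ∈ S̃p_ψ` and ANY implementer `N` of `g`: `M = c • N`, `c ∈ kˣ`;
  `MpPsi.exists_conj_toOp_eq_smul` — **conjugation**: for `q = (g₀, M₀)`, `p = (g, U) ∈ S̃p_ψ` and any implementer `N` of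
  `g₀ g g₀⁻¹`: `M₀ U M₀⁻¹ = c • N` (`c ∈ kˣ`); `MpPsi.exists_conj_toOp_eq_smul_toOp` (the same with `N = op(n)`,
  `n ∈ S̃p_ψ` over `g₀ g g₀⁻¹`); `MpPsi.exists_functional_conj_eq_smul` — **transport of quasi-invariant functionals**: if a
  `k`-linear `Λ : S → M` satisfies `Λ ∘ U = κ • Λ` then `D := Λ ∘ M₀⁻¹` satisfies `D ∘ N = (c κ) • D` (`c ∈ kˣ`).
* §2 the Schrödinger model `ρ = schrodingerSB β ψ` on `𝒮(X)` (`W = X ⊕ Y`, `B = polar β`): a Siegel unipotent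
  `n(b) : (x, y) ↦ (x, y + b x)` (`b : X →ₗ Y` symmetric) is implemented by MULTIPLICATION by the second-degree character
  `x ↦ ψ(−½ β(x, b x))` (`unipotent_mem_MpPsi`, [MoeglinVignerasWaldspurger1987, Chap. 2 II.6], [Weil1964, n° 13]); hence
  (`MpPsi.exists_conj_toOp_apply_eq_mul_psi`) if `g₀ g g₀⁻¹ = n(b)` then `(M₀ U M₀⁻¹ f)(x) = c · ψ(−½ β(x, b x)) · f(x)`, and
  (`MpPsi.exists_functional_conj_unipotent`) `D(ψ(−½β(·, b ·)) · f) = (c κ) • D(f)` for `D = Λ ∘ M₀⁻¹`, `Λ ∘ U = κ • Λ`.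

Use (cell `hodgecm-mathlib`, row IV-4(c1) `rankOne_theta_lines_disjoint`, KEY `b4-rank-one-theta-lines-disjoint` piece
P5 (a)(b)): `ρ = localSchrodinger F 6 (T ⊕ −T) v` (the doubled model, `implementerUniqueUpToScalar_localSchrodinger` with
`IsUnit (T ⊕ −T).det`), `p = 𝔻(n_b)` the diagonal doubling of a root element of `U(V)(F_v)` (`LocalUnitaryDiagonalDoubling`),
`q = (g₀, M₀)` the polarisation mover of P4, `Λ` the functional of P1; output = hypothesis (a) of the quadric-support lemma
P6.  Nothing about theta lifts is asserted here; HC_CM is proved only modulo the 7 printed citations until rung 0 of the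
ladder closes.

## References
* [MoeglinVignerasWaldspurger1987] C. Mœglin, M.-F. Vignéras, J.-L. Waldspurger, *Correspondances de Howe sur un corps
  p-adique*, LNM 1291 (1987), Chap. 2 II.1 (A), II.6.
* [Weil1964] A. Weil, *Sur certains groupes d'opérateurs unitaires*, Acta Math. 111 (1964), n° 13, p. 160.
-/

set_option autoImplicit false

noncomputable section

namespace Literature.RepresentationTheory.HeisenbergGroup

open Literature.NumberTheory.Automorphic (SchwartzBruhat)

/-! ## §1 Any model with implementers unique up to scalar -/

section Generic

variable {R : Type*} [CommRing R] [Invertible (2 : R)] {V : Type*} [AddCommGroup V] [Module R V]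
  {B : V →ₗ[R] V →ₗ[R] R}
variable {k : Type*} [CommRing k] {S : Type*} [AddCommGroup S] [Module k S]
variable (ρ : Representation k (Heisenberg B) S)

/-- **`(g, M) ∈ S̃p_ψ(W)` and any implementer `N` of `g` differ by a unit scalar: `M = c • N`.**
[cite: MoeglinVignerasWaldspurger1987, Chap. 2 II.1 (A)] -/
theorem MpPsi.exists_toOp_eq_smul (hU : ImplementerUniqueUpToScalar ρ) (p : MpPsi ρ) {N : S ≃ₗ[k] S}
    (hN : Implements ρ (ofSymplectic B (MpPsi.proj ρ p)) N) :
    ∃ c : kˣ, ∀ f : S, MpPsi.toOp ρ p f = (c : k) • N f :=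
  hU (MpPsi.proj ρ p) N (MpPsi.toOp ρ p) hN ((mem_MpPsi ρ _).1 p.2)

/-- `op(q p q⁻¹) f = op(q) (op(p) (op(q)⁻¹ f))`. [cite: MoeglinVignerasWaldspurger1987, Chap. 2 II.1 (A)] -/
theorem MpPsi.toOp_conj_apply (q p : MpPsi ρ) (f : S) :
    MpPsi.toOp ρ (q * p * q⁻¹) f = MpPsi.toOp ρ q (MpPsi.toOp ρ p ((MpPsi.toOp ρ q).symm f)) := by
  rw [map_mul, map_mul, map_inv]
  rfl

/-- `π(q p q⁻¹) = π(q) π(p) π(q)⁻¹`. [cite: MoeglinVignerasWaldspurger1987, Chap. 2 II.1 (B)] -/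
theorem MpPsi.proj_conj (q p : MpPsi ρ) :
    MpPsi.proj ρ (q * p * q⁻¹) = MpPsi.proj ρ q * MpPsi.proj ρ p * (MpPsi.proj ρ q)⁻¹ := by
  rw [map_mul, map_mul, map_inv]

/-- **Conjugation of implementers**: for `q = (g₀, M₀)`, `p = (g, U) ∈ S̃p_ψ(W)` and ANY implementer `N` of `g₀ g g₀⁻¹`,
`M₀ U M₀⁻¹ = c • N` with `c ∈ kˣ`. [cite: MoeglinVignerasWaldspurger1987, Chap. 2 II.1 (A)] -/
theorem MpPsi.exists_conj_toOp_eq_smul (hU : ImplementerUniqueUpToScalar ρ) (q p : MpPsi ρ) {N : S ≃ₗ[k] S}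
    (hN : Implements ρ (ofSymplectic B (MpPsi.proj ρ q * MpPsi.proj ρ p * (MpPsi.proj ρ q)⁻¹)) N) :
    ∃ c : kˣ, ∀ f : S, MpPsi.toOp ρ q (MpPsi.toOp ρ p ((MpPsi.toOp ρ q).symm f)) = (c : k) • N f := by
  obtain ⟨c, hc⟩ := MpPsi.exists_toOp_eq_smul ρ hU (q * p * q⁻¹) (N := N) (by rw [MpPsi.proj_conj]; exact hN)
  exact ⟨c, fun f => by rw [← MpPsi.toOp_conj_apply, hc f]⟩

/-- **Conjugation inside `S̃p_ψ(W)`**: if `π(q) π(p) π(q)⁻¹ = π(n)` then `op(q) op(p) op(q)⁻¹ = c • op(n)`, `c ∈ kˣ`.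
[cite: MoeglinVignerasWaldspurger1987, Chap. 2 II.1 (A)] -/
theorem MpPsi.exists_conj_toOp_eq_smul_toOp (hU : ImplementerUniqueUpToScalar ρ) (q p n : MpPsi ρ)
    (h : MpPsi.proj ρ q * MpPsi.proj ρ p * (MpPsi.proj ρ q)⁻¹ = MpPsi.proj ρ n) :
    ∃ c : kˣ, ∀ f : S, MpPsi.toOp ρ q (MpPsi.toOp ρ p ((MpPsi.toOp ρ q).symm f)) = (c : k) • MpPsi.toOp ρ n f :=
  MpPsi.exists_conj_toOp_eq_smul ρ hU q p (N := MpPsi.toOp ρ n) (by rw [h]; exact (mem_MpPsi ρ _).1 n.2)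

/-- **Transport of quasi-invariant functionals through a conjugation.**  If a `k`-linear map `Λ : S → M` is
quasi-invariant under `U = op(p)`, `Λ ∘ U = κ • Λ`, and `N` implements `g₀ g g₀⁻¹` (`q = (g₀, M₀)`), then
`D := Λ ∘ M₀⁻¹` is quasi-invariant under `N`: `D ∘ N = (c κ) • D` for a unit `c`.
[cite: MoeglinVignerasWaldspurger1987, Chap. 2 II.1 (A)] -/
theorem MpPsi.exists_functional_conj_eq_smul (hU : ImplementerUniqueUpToScalar ρ) (q p : MpPsi ρ) {N : S ≃ₗ[k] S}
    (hN : Implements ρ (ofSymplectic B (MpPsi.proj ρ q * MpPsi.proj ρ p * (MpPsi.proj ρ q)⁻¹)) N)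
    {M : Type*} [AddCommGroup M] [Module k M] (Λ : S →ₗ[k] M) (κ : k) (hΛ : ∀ f : S, Λ (MpPsi.toOp ρ p f) = κ • Λ f) :
    ∃ c : kˣ, ∀ f : S, Λ ((MpPsi.toOp ρ q).symm (N f)) = ((c : k) * κ) • Λ ((MpPsi.toOp ρ q).symm f) := by
  obtain ⟨c, hc⟩ := MpPsi.exists_conj_toOp_eq_smul ρ hU q p hN
  refine ⟨c⁻¹, fun f => ?_⟩
  have h1 : (MpPsi.toOp ρ q).symm (N f) = ((c⁻¹ : kˣ) : k) • MpPsi.toOp ρ p ((MpPsi.toOp ρ q).symm f) := by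
    apply (MpPsi.toOp ρ q).injective
    rw [LinearEquiv.apply_symm_apply, map_smul, hc f, smul_smul, Units.inv_mul, one_smul]
  rw [h1, map_smul, hΛ, smul_smul]

end Generic

/-! ## §2 The Schrödinger model: conjugates landing on a Siegel unipotent act by a second-degree character -/

section Schrodinger

variable {R : Type*} [CommRing R] [Invertible (2 : R)] {X Y : Type*} [AddCommGroup X] [Module R X] [AddCommGroup Y]
  [Module R Y] (β : X →ₗ[R] Y →ₗ[R] R) (ψ : AddChar R Circle)
variable [TopologicalSpace X] [TopologicalSpace R] [IsTopologicalAddGroup X] [ContinuousNeg R]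
  (hψ : IsLocallyConstant (⇑ψ : R → Circle)) (hβ : ∀ y : Y, Continuous fun u : X => β u y)

/-- **(a) + (b): a conjugate `M₀ U M₀⁻¹` lying over a Siegel unipotent `n(b)` is `c ·` (multiplication by
`ψ(−½ β(x, b x))`)** — `n(b)` is implemented by that multiplication operator (`unipotent_mem_MpPsi`) and implementers are
unique up to scalar. [cite: MoeglinVignerasWaldspurger1987, Chap. 2 II.1 (A), II.6] [cite: Weil1964, n° 13, p. 160] -/
theorem MpPsi.exists_conj_toOp_eq_smul_unipotentEquivSB
    (hU : ImplementerUniqueUpToScalar (schrodingerSB β ψ hψ hβ)) (q p : MpPsi (schrodingerSB β ψ hψ hβ))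
    (b : X →ₗ[R] Y) (hb : ∀ x x', β x (b x') = β x' (b x)) (hq : Continuous fun x : X => ⅟(2 : R) * β x (b x))
    (h : MpPsi.proj _ q * MpPsi.proj _ p * (MpPsi.proj _ q)⁻¹ = unipotentSp β b hb) :
    ∃ c : ℂˣ, ∀ f : SchwartzBruhat X,
      MpPsi.toOp _ q (MpPsi.toOp _ p ((MpPsi.toOp _ q).symm f)) =
        (c : ℂ) • unipotentEquivSB ψ hψ (fun x : X => ⅟(2 : R) * β x (b x)) hq f := by
  have hN := unipotent_mem_MpPsi β ψ hψ hβ b hb hq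
  rw [mem_MpPsi] at hN
  exact MpPsi.exists_conj_toOp_eq_smul _ hU q p (N := unipotentEquivSB ψ hψ (fun x : X => ⅟(2 : R) * β x (b x)) hq)
    (by rw [h]; exact hN)

/-- pointwise form: `(M₀ U M₀⁻¹ f)(x) = c · ψ(−½ β(x, b x)) · f(x)`.
[cite: MoeglinVignerasWaldspurger1987, Chap. 2 II.1 (A), II.6] [cite: Weil1964, n° 13, p. 160] -/
theorem MpPsi.exists_conj_toOp_apply_eq_mul_psi
    (hU : ImplementerUniqueUpToScalar (schrodingerSB β ψ hψ hβ)) (q p : MpPsi (schrodingerSB β ψ hψ hβ))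
    (b : X →ₗ[R] Y) (hb : ∀ x x', β x (b x') = β x' (b x)) (hq : Continuous fun x : X => ⅟(2 : R) * β x (b x))
    (h : MpPsi.proj _ q * MpPsi.proj _ p * (MpPsi.proj _ q)⁻¹ = unipotentSp β b hb) :
    ∃ c : ℂˣ, ∀ (f : SchwartzBruhat X) (x : X),
      ((MpPsi.toOp _ q (MpPsi.toOp _ p ((MpPsi.toOp _ q).symm f)) : SchwartzBruhat X) : X → ℂ) x =
        (c : ℂ) * ((ψ (-(⅟(2 : R) * β x (b x))) : ℂ) * (f : X → ℂ) x) := by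
  obtain ⟨c, hc⟩ := MpPsi.exists_conj_toOp_eq_smul_unipotentEquivSB β ψ hψ hβ hU q p b hb hq h
  refine ⟨c, fun f x => ?_⟩
  rw [hc f, Submodule.coe_smul, Pi.smul_apply, smul_eq_mul, coe_unipotentEquivSB, unipotentOp_apply]

/-- **Transport of a quasi-invariant functional onto the unipotent picture**: if `Λ ∘ U = κ • Λ` (`p = (g, U)`) and
`g₀ g g₀⁻¹ = n(b)` (`q = (g₀, M₀)`), then `D := Λ ∘ M₀⁻¹` satisfies `D(ψ(−½β(·, b·)) · f) = (c κ) • D(f)` for all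
`f ∈ 𝒮(X)`, `c ∈ ℂˣ` — hypothesis (a) of the quadric-support lemma.
[cite: MoeglinVignerasWaldspurger1987, Chap. 2 II.1 (A), II.6] [cite: Weil1964, n° 13, p. 160] -/
theorem MpPsi.exists_functional_conj_unipotent
    (hU : ImplementerUniqueUpToScalar (schrodingerSB β ψ hψ hβ)) (q p : MpPsi (schrodingerSB β ψ hψ hβ))
    (b : X →ₗ[R] Y) (hb : ∀ x x', β x (b x') = β x' (b x)) (hq : Continuous fun x : X => ⅟(2 : R) * β x (b x))
    (h : MpPsi.proj _ q * MpPsi.proj _ p * (MpPsi.proj _ q)⁻¹ = unipotentSp β b hb)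
    {M : Type*} [AddCommGroup M] [Module ℂ M] (Λ : SchwartzBruhat X →ₗ[ℂ] M) (κ : ℂ)
    (hΛ : ∀ f : SchwartzBruhat X, Λ (MpPsi.toOp _ p f) = κ • Λ f) :
    ∃ c : ℂˣ, ∀ f : SchwartzBruhat X,
      Λ ((MpPsi.toOp _ q).symm (unipotentEquivSB ψ hψ (fun x : X => ⅟(2 : R) * β x (b x)) hq f)) =
        ((c : ℂ) * κ) • Λ ((MpPsi.toOp _ q).symm f) := by
  have hN := unipotent_mem_MpPsi β ψ hψ hβ b hb hq
  rw [mem_MpPsi] at hN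
  exact MpPsi.exists_functional_conj_eq_smul _ hU q p
    (N := unipotentEquivSB ψ hψ (fun x : X => ⅟(2 : R) * β x (b x)) hq) (by rw [h]; exact hN) Λ κ hΛ

end Schrodinger

end Literature.RepresentationTheory.HeisenbergGroup

end
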